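import Literature.NumberTheory.Automorphic.UnitaryGroupAdelicCharactersDetAllRanks
import Literature.NumberTheory.Automorphic.UnitaryIsotropicAbelianization
import Literature.NumberTheory.Automorphic.UnitaryRankThreeDiagonal
import Literature.NumberTheory.QuadraticForms.LandherrHermitianMatricesDiagonalize
import HarnessLib

/-!
# The abelianization of `U(p, q)` and of the archimedean local factors `U(σ_w J)(ℂ)`: `U′ = SU`, `U ∕ SU ≅ S¹` via `det`

Topic `NumberTheory/Automorphic`; namespace `Literature.NumberTheory.Automorphic.UnitaryGroup.ArchAbelianization`.  KERNEL only
(theorems, no definition, no notation, no instance, no named fact, no `sorry`).  The ARCHIMEDEAN companion of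
✔ `Automorphic/UnitaryIsotropicAbelianization` (isotropic forms over any field) and ✔ `LinearAlgebra/Matrix/UnitaryGroupHomDet`
(definite forms over `ℂ`): for the unitary group `U(diag r)(ℂ) = unitaryGroupOfForm (starRingEnd ℂ) (diag r)` of a REAL non-degenerate
diagonal form of ANY signature `(p, q)` —

* §1 **`commutator_eq_ker_det_real_diagonal`** — `U(p, q)′ = SU(p, q)`: the commutator subgroup is the kernel of `det` (definite:
  ✔ `UnitaryHomDet.apply_eq_one_of_det_eq_one_diagonal_pos ∕ _neg`; indefinite: the isotropic vector `√(−r_j) e_i + √(r_i) e_j` and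
  ✔ `UnitaryIsotropic.apply_eq_one_of_det_eq_one`), and **`commutator_eq_ker_det_one`** for the standard `U(N)` (`J = 1`);
  **`mem_range_det_iff_norm_eq_one`** — `det(U(p, q)) = S¹ = {u : ‖u‖ = 1}` (`N ≥ 1`; quasi-symmetries, ✔ `UnitaryIsotropic.mem_range_det_iff`);
  **`apply_eq_of_det_eq_real_diagonal`**, **`existsUnique_eq_comp_rangeRestrict_det_real_diagonal`** (every homomorphism to a commutative
  group is `ψ ∘ det` for a UNIQUE `ψ` on `det(U) = S¹`), **`bijective_abelianizationLift_det_real_diagonal`** (`U(p, q)^{ab} ≅ S¹`).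
* §2 the archimedean local factors of a CM field `L`: at a complex place `w`, `U(σ_w J)(ℂ) = UnitaryGroup.archLocal L N J w` for ANY
  hermitian non-degenerate `J ∈ M_N(L)` (Landherr congruence over `L` to a real diagonal form, ✔ `Landherr.exists_congr_diagonal`, transported
  along `σ_w` by ✔ `UnitaryRankThree.apply_eq_one_of_det_eq_one_of_formCongr`): **`commutator_archLocal_eq_ker_det`**,
  **`apply_eq_of_det_eq_archLocal`**, **`existsUnique_eq_comp_rangeRestrict_det_archLocal`**, **`bijective_abelianizationLift_det_archLocal`**,
  and for diagonal `J` **`mem_range_det_archLocal_iff_norm_eq_one`** (`det(U(σ_w J)(ℂ)) = S¹`).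

With ✔ `Liu2021/…CharacterDecisionAllRanksAbelianizationSplit` (every FINITE place) this completes the picture «at every place of `L⁺` the
one-dimensional characters of the local unitary group are the characters of the local norm-one torus composed with `det`»
([GelbartRogawski1991, §3.1 Remark p. 457]; [Dieudonne1971GroupesClassiques, Chap. II §5]).  HC_CM is NOT proved.

## References

* J. Dieudonné, *La géométrie des groupes classiques*, 3e éd., Springer (1971), Chap. II §5 [Dieudonne1971GroupesClassiques].
* W. Landherr, *Äquivalenz Hermitescher Formen über einem beliebigen algebraischen Zahlkörper*, Abh. Math. Sem. Hamburg 11 (1936)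
  [Landherr1936HermitianForms].
-/

set_option autoImplicit false

noncomputable section

open NumberField Matrix
open scoped MatrixGroups

namespace Literature.NumberTheory.Automorphic

namespace UnitaryGroup.ArchAbelianization

open Literature.LinearAlgebra.Matrix NumberField.InfinitePlace
open Literature.NumberTheory.QuadraticForms (Landherr.conjTranspose Landherr.conjTranspose_apply Landherr.exists_congr_diagonal)

/-! ## §0 Pure group theory (private): `commutator G = ker f` from a kills property, and its consequences -/

section GroupTheory

variable {G M A : Type*} [Group G] [CommGroup M] [CommGroup A]

/-- If `S = T` as subgroups and every hom on `T` kills the elements satisfying `P`, so does every hom on `S`. [folklore] -/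
private theorem kills_of_eq {H : Type*} [Group H] {S T : Subgroup H} (e : S = T) (P : H → Prop)
    (hT : ∀ (θ' : ↥T →* A) (y : ↥T), P y.1 → θ' y = 1) (θ : ↥S →* A) (x : ↥S) (hx : P x.1) : θ x = 1 := by
  subst e
  exact hT θ x hx

/-- `commutator G = ker f` as soon as `ker f` dies in `G^{ab}`. [folklore] -/
private theorem commutator_eq_ker_of_kills (f : G →* M)
    (h : ∀ g : G, f g = 1 → (Abelianization.of g : Abelianization G) = 1) : commutator G = f.ker := by
  refine le_antisymm (Abelianization.commutator_subset_ker f) fun g hg => ?_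
  have key := h g ((MonoidHom.mem_ker).1 hg)
  rwa [← MonoidHom.mem_ker, Abelianization.ker_of] at key

/-- From `commutator G = ker f`: a homomorphism to a commutative group depends on `f` only. [folklore] -/
private theorem apply_eq_of_commutator_eq (f : G →* M) (hc : commutator G = f.ker) (χ : G →* A) (g h : G)
    (hgh : f g = f h) : χ g = χ h := by
  have hmem : g * h⁻¹ ∈ χ.ker := by
    refine Abelianization.commutator_subset_ker χ ?_
    rw [hc, MonoidHom.mem_ker, map_mul, map_inv, hgh, mul_inv_cancel]
  rwa [MonoidHom.mem_ker, map_mul, map_inv, mul_inv_eq_one] at hmem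

/-- From `commutator G = ker f`: every homomorphism to a commutative group is `ψ ∘ f.rangeRestrict` for a UNIQUE `ψ`. [folklore] -/
private theorem existsUnique_eq_comp_rangeRestrict_of_commutator_eq (f : G →* M) (hc : commutator G = f.ker) (χ : G →* A) :
    ∃! ψ : ↥f.range →* A, χ = ψ.comp f.rangeRestrict := by
  have hsurj : Function.Surjective f.rangeRestrict := MonoidHom.rangeRestrict_surjective f
  have hker : f.rangeRestrict.ker ≤ χ.ker := by
    rw [MonoidHom.ker_rangeRestrict, ← hc]
    exact Abelianization.commutator_subset_ker χ
  refine ⟨MonoidHom.liftOfSurjective _ hsurj ⟨χ, hker⟩, ?_, fun ψ hψ => ?_⟩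
  · exact (MonoidHom.liftOfRightInverse_comp _ (Function.surjInv hsurj) (Function.rightInverse_surjInv hsurj) ⟨χ, hker⟩).symm
  · ext y
    obtain ⟨g, rfl⟩ := hsurj y
    rw [MonoidHom.liftOfRightInverse_comp_apply]
    exact (congrArg (fun φ : G →* A => φ g) hψ).symm

/-- From `commutator G = ker f`: `G^{ab} → f(G)`, `[g] ↦ f g`, is bijective. [folklore] -/
private theorem bijective_lift_rangeRestrict_of_commutator_eq (f : G →* M) (hc : commutator G = f.ker) :
    Function.Bijective (Abelianization.lift f.rangeRestrict) := by
  have hofs : Function.Surjective (Abelianization.of : G →* Abelianization G) :=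
    fun x => QuotientGroup.induction_on x fun g => ⟨g, rfl⟩
  constructor
  · rw [← MonoidHom.ker_eq_bot_iff, eq_bot_iff]
    intro x hx
    obtain ⟨g, rfl⟩ := hofs x
    rw [MonoidHom.mem_ker, Abelianization.lift_apply_of] at hx
    have hg : g ∈ f.ker := by rw [← MonoidHom.ker_rangeRestrict, MonoidHom.mem_ker]; exact hx
    rw [← hc, ← Abelianization.ker_of] at hg
    rw [Subgroup.mem_bot]
    exact (MonoidHom.mem_ker).1 hg
  · intro y
    obtain ⟨g, rfl⟩ := MonoidHom.rangeRestrict_surjective f y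
    exact ⟨Abelianization.of g, Abelianization.lift_apply_of _ _⟩

end GroupTheory

/-! ## §1 `U(p, q)` over `ℂ`: real non-degenerate diagonal forms of any signature -/

section Complex

variable {A : Type*} [CommGroup A] {N : ℕ} (r : Fin N → ℝ) (hr0 : ∀ i, r i ≠ 0)

/-- The real diagonal form `diag(r)` is hermitian for complex conjugation. [folklore] -/
private theorem diagonal_hermitian :
    ((Matrix.diagonal fun k => ((r k : ℝ) : ℂ)).map (starRingEnd ℂ)).transpose = Matrix.diagonal fun k => ((r k : ℝ) : ℂ) := by
  rw [Matrix.diagonal_map (map_zero _), Matrix.diagonal_transpose]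
  congr 1
  funext k
  exact Complex.conj_ofReal _

include hr0 in
/-- The real diagonal form `diag(r)`, `rᵢ ≠ 0`, is non-degenerate. [folklore] -/
private theorem diagonal_det_ne_zero : (Matrix.diagonal fun k => ((r k : ℝ) : ℂ)).det ≠ 0 := by
  rw [Matrix.det_diagonal]
  exact Finset.prod_ne_zero_iff.2 fun k _ => by exact_mod_cast hr0 k

include hr0 in
/-- Every homomorphism `U(diag r)(ℂ) →* A` to a commutative group kills `{det = 1}` — for EVERY signature: definite by
✔ `UnitaryHomDet`, indefinite by the general-rank isotropic engine ✔ `UnitaryIsotropic` at the isotropic vector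
`√(−r_j) e_i + √(r_i) e_j` (the proof of ✔ `AdelicCharactersDetAllRanks.archLocal_apply_eq_one`, freed of the number field).
[cite: Dieudonne1971GroupesClassiques, Chap. II §5] -/
private theorem kills_real_diagonal (θ : ↥(unitaryGroupOfForm (starRingEnd ℂ) (Matrix.diagonal fun k => ((r k : ℝ) : ℂ))) →* A)
    (y : ↥(unitaryGroupOfForm (starRingEnd ℂ) (Matrix.diagonal fun k => ((r k : ℝ) : ℂ)))) (hy : y.1.1.det = 1) : θ y = 1 := by
  classical
  by_cases hpos : ∀ i, 0 < r i
  · exact UnitaryHomDet.apply_eq_one_of_det_eq_one_diagonal_pos r hpos θ y hy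
  by_cases hneg : ∀ i, r i < 0
  · exact UnitaryHomDet.apply_eq_one_of_det_eq_one_diagonal_neg r hneg θ y hy
  -- indefinite: an explicit isotropic vector
  simp only [not_forall, not_lt] at hpos hneg
  obtain ⟨j, hj⟩ := hpos
  obtain ⟨i, hi⟩ := hneg
  have hj' : r j < 0 := lt_of_le_of_ne hj (hr0 j)
  have hi' : 0 < r i := lt_of_le_of_ne hi (Ne.symm (hr0 i))
  have hij : i ≠ j := fun h => by rw [h] at hi'; exact lt_irrefl _ (hi'.trans hj')
  refine UnitaryIsotropic.apply_eq_one_of_det_eq_one (σ := starRingEnd ℂ) (θ₀ := Complex.I)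
    Complex.conj_conj Complex.conj_I Complex.I_ne_zero two_ne_zero (Matrix.diagonal fun k => ((r k : ℝ) : ℂ))
    (diagonal_hermitian r) (diagonal_det_ne_zero r hr0) ?_ θ y hy
  refine ⟨fun k => if k = i then ((Real.sqrt (-r j) : ℝ) : ℂ) else if k = j then ((Real.sqrt (r i) : ℝ) : ℂ) else 0,
    ?_, ?_⟩
  · intro h0
    have := congrFun h0 i
    simp only [if_true, Pi.zero_apply, Complex.ofReal_eq_zero] at this
    exact (Real.sqrt_pos.2 (neg_pos.2 hj')).ne' this
  · have hsi : ((Real.sqrt (-r j) : ℝ) : ℂ) * (Real.sqrt (-r j) : ℝ) = ((-r j : ℝ) : ℂ) := by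
      exact_mod_cast Real.mul_self_sqrt (neg_pos.2 hj').le
    have hsj : ((Real.sqrt (r i) : ℝ) : ℂ) * (Real.sqrt (r i) : ℝ) = ((r i : ℝ) : ℂ) := by
      exact_mod_cast Real.mul_self_sqrt hi'.le
    rw [dotProduct]
    simp only [Matrix.mulVec_diagonal]
    rw [Finset.sum_eq_add_of_mem i j (Finset.mem_univ i) (Finset.mem_univ j) hij]
    · simp only [if_true, if_neg (Ne.symm hij), Complex.conj_ofReal]
      calc (Real.sqrt (-r j) : ℂ) * ((r i : ℂ) * (Real.sqrt (-r j) : ℂ)) +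
            (Real.sqrt (r i) : ℂ) * ((r j : ℂ) * (Real.sqrt (r i) : ℂ))
          = (r i : ℂ) * (((Real.sqrt (-r j) : ℝ) : ℂ) * (Real.sqrt (-r j) : ℝ)) +
            (r j : ℂ) * (((Real.sqrt (r i) : ℝ) : ℂ) * (Real.sqrt (r i) : ℝ)) := by ring
        _ = 0 := by rw [hsi, hsj]; push_cast; ring
    · intro k _ hk
      simp only [if_neg hk.1, if_neg hk.2, map_zero, zero_mul]

include hr0 in
/-- **`U(p, q)′ = SU(p, q)`** — for a real non-degenerate diagonal form `diag(r)` of ANY signature, the commutator subgroup of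
`U(diag r)(ℂ) = unitaryGroupOfForm (starRingEnd ℂ) (diag r)` is the kernel of `det`. [cite: Dieudonne1971GroupesClassiques, Chap. II §5] -/
theorem commutator_eq_ker_det_real_diagonal :
    commutator ↥(unitaryGroupOfForm (starRingEnd ℂ) (Matrix.diagonal fun k => ((r k : ℝ) : ℂ))) =
      (Matrix.GeneralLinearGroup.det.comp (unitaryGroupOfForm (starRingEnd ℂ) (Matrix.diagonal fun k => ((r k : ℝ) : ℂ))).subtype).ker :=
  commutator_eq_ker_of_kills _ fun g hg => kills_real_diagonal r hr0 Abelianization.of g (by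
    rw [MonoidHom.comp_apply, Subgroup.subtype_apply] at hg
    rw [← Matrix.GeneralLinearGroup.val_det_apply, hg, Units.val_one])

include hr0 in
/-- **Membership form: `g ∈ U(p, q)′ ↔ det g = 1`.** [cite: Dieudonne1971GroupesClassiques, Chap. II §5] -/
theorem mem_commutator_iff_det_eq_one_real_diagonal
    (g : ↥(unitaryGroupOfForm (starRingEnd ℂ) (Matrix.diagonal fun k => ((r k : ℝ) : ℂ)))) :
    g ∈ commutator ↥(unitaryGroupOfForm (starRingEnd ℂ) (Matrix.diagonal fun k => ((r k : ℝ) : ℂ))) ↔ g.1.1.det = 1 := by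
  rw [commutator_eq_ker_det_real_diagonal r hr0, MonoidHom.mem_ker, MonoidHom.comp_apply, Subgroup.subtype_apply,
    ← Matrix.GeneralLinearGroup.val_det_apply, Units.val_eq_one]

/-- **`U(N)′ = SU(N)`** for the standard compact unitary group `U(N) = {g ∣ gᴴ g = 1} = unitaryGroupOfForm (starRingEnd ℂ) 1`
(✔ `UnitaryHomDet.apply_eq_one_of_det_eq_one_one` applied to `U(N) → U(N)^{ab}`). [cite: Dieudonne1971GroupesClassiques, Chap. II §5] -/
theorem commutator_eq_ker_det_one :
    commutator ↥(unitaryGroupOfForm (starRingEnd ℂ) (1 : Matrix (Fin N) (Fin N) ℂ)) =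
      (Matrix.GeneralLinearGroup.det.comp (unitaryGroupOfForm (starRingEnd ℂ) (1 : Matrix (Fin N) (Fin N) ℂ)).subtype).ker :=
  commutator_eq_ker_of_kills _ fun g hg => UnitaryHomDet.apply_eq_one_of_det_eq_one_one Abelianization.of g (by
    rw [MonoidHom.comp_apply, Subgroup.subtype_apply] at hg
    rw [← Matrix.GeneralLinearGroup.val_det_apply, hg, Units.val_one])

include hr0 in
/-- **`det(U(p, q)) = S¹`** (`N ≥ 1`): a unit `u ∈ ℂˣ` is the determinant of an element of `U(diag r)(ℂ)` iff `‖u‖ = 1` (the quasi-symmetries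
of ✔ `UnitaryIsotropic.mem_range_det_iff`, `conj u · u = ‖u‖²`). [cite: Dieudonne1971GroupesClassiques, Chap. II §§4–5] -/
theorem mem_range_det_iff_norm_eq_one [NeZero N] (u : ℂˣ) :
    u ∈ (Matrix.GeneralLinearGroup.det.comp (unitaryGroupOfForm (starRingEnd ℂ) (Matrix.diagonal fun k => ((r k : ℝ) : ℂ))).subtype).range ↔
      ‖(u : ℂ)‖ = 1 := by
  rw [UnitaryIsotropic.mem_range_det_iff (σ := starRingEnd ℂ) (θ₀ := Complex.I) Complex.conj_conj Complex.conj_I Complex.I_ne_zero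
    two_ne_zero (Matrix.diagonal fun k => ((r k : ℝ) : ℂ)) (diagonal_hermitian r) (diagonal_det_ne_zero r hr0) u, Complex.conj_mul']
  constructor
  · intro h
    have h' : ‖(u : ℂ)‖ ^ 2 = 1 := by exact_mod_cast h
    exact (pow_eq_one_iff_of_nonneg (norm_nonneg _) two_ne_zero).1 h'
  · intro h
    rw [h]; norm_num

include hr0 in
/-- **A homomorphism `U(p, q) →* A` to a commutative group depends on `det` only.** [cite: Dieudonne1971GroupesClassiques, Chap. II §5] -/
theorem apply_eq_of_det_eq_real_diagonal (θ : ↥(unitaryGroupOfForm (starRingEnd ℂ) (Matrix.diagonal fun k => ((r k : ℝ) : ℂ))) →* A)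
    (g h : ↥(unitaryGroupOfForm (starRingEnd ℂ) (Matrix.diagonal fun k => ((r k : ℝ) : ℂ)))) (hgh : g.1.1.det = h.1.1.det) :
    θ g = θ h :=
  apply_eq_of_commutator_eq _ (commutator_eq_ker_det_real_diagonal r hr0) θ g h (Units.ext (by
    rw [MonoidHom.comp_apply, MonoidHom.comp_apply, Subgroup.subtype_apply, Subgroup.subtype_apply,
      Matrix.GeneralLinearGroup.val_det_apply, Matrix.GeneralLinearGroup.val_det_apply]
    exact hgh))

include hr0 in
/-- **Unique factorisation through `det : U(p, q) ↠ S¹`**: every homomorphism `θ : U(diag r)(ℂ) →* A` to a commutative group is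
`ψ ∘ det` for a UNIQUE `ψ` on `det(U) = S¹`. [cite: Dieudonne1971GroupesClassiques, Chap. II §5] -/
theorem existsUnique_eq_comp_rangeRestrict_det_real_diagonal
    (θ : ↥(unitaryGroupOfForm (starRingEnd ℂ) (Matrix.diagonal fun k => ((r k : ℝ) : ℂ))) →* A) :
    ∃! ψ : ↥(Matrix.GeneralLinearGroup.det.comp
        (unitaryGroupOfForm (starRingEnd ℂ) (Matrix.diagonal fun k => ((r k : ℝ) : ℂ))).subtype).range →* A,
      θ = ψ.comp (Matrix.GeneralLinearGroup.det.comp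
        (unitaryGroupOfForm (starRingEnd ℂ) (Matrix.diagonal fun k => ((r k : ℝ) : ℂ))).subtype).rangeRestrict :=
  existsUnique_eq_comp_rangeRestrict_of_commutator_eq _ (commutator_eq_ker_det_real_diagonal r hr0) θ

include hr0 in
/-- **`U(p, q)^{ab} ≅ S¹`**: `U(diag r)(ℂ)^{ab} → det(U) (= S¹)`, `[g] ↦ det g`, is BIJECTIVE. [cite: Dieudonne1971GroupesClassiques, Chap. II §5] -/
theorem bijective_abelianizationLift_det_real_diagonal :
    Function.Bijective (Abelianization.lift (Matrix.GeneralLinearGroup.det.comp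
      (unitaryGroupOfForm (starRingEnd ℂ) (Matrix.diagonal fun k => ((r k : ℝ) : ℂ))).subtype).rangeRestrict) :=
  bijective_lift_rangeRestrict_of_commutator_eq _ (commutator_eq_ker_det_real_diagonal r hr0)

end Complex

/-! ## §2 The archimedean local factors `U(σ_w J)(ℂ) = UnitaryGroup.archLocal L N J w` of a CM field -/

section CM

open Literature.NumberTheory.GelbartRogawski1991.UnitaryDualPair (imagUnit complexConj_imagUnit imagUnit_ne_zero)

variable (L : Type) [Field L] [NumberField L] [IsCMField L] {A : Type*} [CommGroup A] {N : ℕ}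
  (J : Matrix (Fin N) (Fin N) L) (hJh : (J.map (IsCMField.complexConj L))ᵀ = J) (hJdet : J.det ≠ 0)

include hJh hJdet in
/-- At a complex place `w` of the CM field `L`, every homomorphism `U(σ_w J)(ℂ) →* A` to a commutative group kills `{det = 1}`, for ANY
hermitian non-degenerate `J ∈ M_N(L)`: Landherr's congruence `ᵗḠ J G = diag d` over `L` (✔ `Landherr.exists_congr_diagonal`) is read through
`σ_w` (`σ_w ∘ c̄ = conj ∘ σ_w`, ✔ `embedding_galConj`), transporting §1 along ✔ `UnitaryRankThree.apply_eq_one_of_det_eq_one_of_formCongr`.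
[cite: Dieudonne1971GroupesClassiques, Chap. II §5] [cite: Landherr1936HermitianForms] -/
private theorem kills_archLocal (w : {w : InfinitePlace L // IsComplex w}) (θ : ↥(UnitaryGroup.archLocal L N J w) →* A)
    (x : ↥(UnitaryGroup.archLocal L N J w)) (hx : x.1.1.det = 1) : θ x = 1 := by
  classical
  have hc : IsCMField.complexConj L ≠ 1 := IsCMField.complexConj_ne_one L
  have hfix := UnitaryGroup.complexConj_smul_infinitePlace L
  have hcomp : ∀ y : L, starRingEnd ℂ (w.1.embedding y) = w.1.embedding (IsCMField.complexConj L y) := fun y =>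
    (UnitaryGroup.embedding_galConj (↥(maximalRealSubfield L)) L (IsCMField.complexConj L) w (hfix w.1) hc y).symm
  -- Landherr's congruence over `L`
  have hJh' : Landherr.conjTranspose L J = J := by
    change (Jᵀ).map (IsCMField.complexConj L) = J
    rw [Matrix.transpose_map]
    exact hJh
  obtain ⟨G, hG, d, hd, hd0, hcong⟩ := Landherr.exists_congr_diagonal L J hJh' hJdet
  -- read through `σ_w`
  have hGφ : IsUnit (G.map w.1.embedding) := by
    rw [Matrix.isUnit_iff_isUnit_det, ← RingHom.mapMatrix_apply, ← RingHom.map_det]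
    exact hG.map _
  let T : GL (Fin N) ℂ := hGφ.unit
  have hT : T.1 = G.map w.1.embedding := hGφ.unit_spec
  set r : Fin N → ℝ := fun i => (w.1.embedding (d i)).re with hr_def
  have hreal : ∀ i, w.1.embedding (d i) = ((r i : ℝ) : ℂ) := by
    intro i
    have h := hcomp (d i)
    rw [hd] at h
    exact (Complex.conj_eq_iff_re.1 h).symm
  have hr0 : ∀ i, r i ≠ 0 := by
    intro i h0
    apply hd0 i
    have : w.1.embedding (d i) = 0 := by rw [hreal, h0]; simp
    exact (map_eq_zero _).1 this
  have hA : (T.1.map (starRingEnd ℂ))ᵀ = (Landherr.conjTranspose L G).map w.1.embedding := by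
    rw [hT]
    ext i j
    simp only [Matrix.transpose_apply, Matrix.map_apply, Landherr.conjTranspose_apply, hcomp]
  have hcongr : formCongr (starRingEnd ℂ) T (J.map w.1.embedding) = Matrix.diagonal fun i => ((r i : ℝ) : ℂ) := by
    change (T.1.map (starRingEnd ℂ))ᵀ * _ * T.1 = _
    rw [hA, hT, ← Matrix.map_mul, ← Matrix.map_mul, hcong, Matrix.diagonal_map (map_zero _)]
    congr 1
    funext i
    exact hreal i
  have hM : UnitaryGroup.archLocal L N J w = unitaryGroupOfForm (starRingEnd ℂ) (J.map w.1.embedding) := rfl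
  refine kills_of_eq hM (fun y => (y : Matrix (Fin N) (Fin N) ℂ).det = 1) ?_ θ x hx
  intro θ' y hy
  exact UnitaryRankThree.apply_eq_one_of_det_eq_one_of_formCongr T _ _ hcongr
    (fun χ' g' h' => kills_real_diagonal r hr0 χ' g' h') θ' y hy

include hJh hJdet in
/-- **`U(σ_w J)(ℂ)′ = SU(σ_w J)(ℂ)`** at every complex place `w` of the CM field `L`, for ANY hermitian non-degenerate `J ∈ M_N(L)`: the commutator
subgroup of the archimedean local factor `UnitaryGroup.archLocal L N J w` is the kernel of `det`. [cite: Dieudonne1971GroupesClassiques, Chap. II §5]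
[cite: Landherr1936HermitianForms] -/
theorem commutator_archLocal_eq_ker_det (w : {w : InfinitePlace L // IsComplex w}) :
    commutator ↥(UnitaryGroup.archLocal L N J w) =
      (Matrix.GeneralLinearGroup.det.comp (UnitaryGroup.archLocal L N J w).subtype).ker :=
  commutator_eq_ker_of_kills _ fun g hg => kills_archLocal L J hJh hJdet w Abelianization.of g (by
    rw [MonoidHom.comp_apply, Subgroup.subtype_apply] at hg
    rw [← Matrix.GeneralLinearGroup.val_det_apply, hg, Units.val_one])

include hJh hJdet in
/-- **Membership form: `g ∈ U(σ_w J)(ℂ)′ ↔ det g = 1`.** [cite: Dieudonne1971GroupesClassiques, Chap. II §5] -/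
theorem mem_commutator_archLocal_iff_det_eq_one (w : {w : InfinitePlace L // IsComplex w}) (g : ↥(UnitaryGroup.archLocal L N J w)) :
    g ∈ commutator ↥(UnitaryGroup.archLocal L N J w) ↔ g.1.1.det = 1 := by
  rw [commutator_archLocal_eq_ker_det L J hJh hJdet w, MonoidHom.mem_ker, MonoidHom.comp_apply, Subgroup.subtype_apply,
    ← Matrix.GeneralLinearGroup.val_det_apply, Units.val_eq_one]

include hJh hJdet in
/-- **A homomorphism `U(σ_w J)(ℂ) →* A` to a commutative group depends on `det` only.** [cite: Dieudonne1971GroupesClassiques, Chap. II §5] -/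
theorem apply_eq_of_det_eq_archLocal (w : {w : InfinitePlace L // IsComplex w}) (θ : ↥(UnitaryGroup.archLocal L N J w) →* A)
    (g h : ↥(UnitaryGroup.archLocal L N J w)) (hgh : g.1.1.det = h.1.1.det) : θ g = θ h :=
  apply_eq_of_commutator_eq _ (commutator_archLocal_eq_ker_det L J hJh hJdet w) θ g h (Units.ext (by
    rw [MonoidHom.comp_apply, MonoidHom.comp_apply, Subgroup.subtype_apply, Subgroup.subtype_apply,
      Matrix.GeneralLinearGroup.val_det_apply, Matrix.GeneralLinearGroup.val_det_apply]
    exact hgh))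

include hJh hJdet in
/-- **Unique factorisation through `det`** at a complex place: every homomorphism `θ : U(σ_w J)(ℂ) →* A` to a commutative group is
`ψ ∘ det` for a UNIQUE `ψ` on `det(U(σ_w J)(ℂ))`. [cite: Dieudonne1971GroupesClassiques, Chap. II §5] -/
theorem existsUnique_eq_comp_rangeRestrict_det_archLocal (w : {w : InfinitePlace L // IsComplex w})
    (θ : ↥(UnitaryGroup.archLocal L N J w) →* A) :
    ∃! ψ : ↥(Matrix.GeneralLinearGroup.det.comp (UnitaryGroup.archLocal L N J w).subtype).range →* A,
      θ = ψ.comp (Matrix.GeneralLinearGroup.det.comp (UnitaryGroup.archLocal L N J w).subtype).rangeRestrict :=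
  existsUnique_eq_comp_rangeRestrict_of_commutator_eq _ (commutator_archLocal_eq_ker_det L J hJh hJdet w) θ

include hJh hJdet in
/-- **`U(σ_w J)(ℂ)^{ab} ≅ det(U(σ_w J)(ℂ))`** (`= S¹`, see `mem_range_det_archLocal_iff_norm_eq_one`): `[g] ↦ det g` is BIJECTIVE.
[cite: Dieudonne1971GroupesClassiques, Chap. II §5] -/
theorem bijective_abelianizationLift_det_archLocal (w : {w : InfinitePlace L // IsComplex w}) :
    Function.Bijective (Abelianization.lift
      (Matrix.GeneralLinearGroup.det.comp (UnitaryGroup.archLocal L N J w).subtype).rangeRestrict) :=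
  bijective_lift_rangeRestrict_of_commutator_eq _ (commutator_archLocal_eq_ker_det L J hJh hJdet w)

/-- **`det(U(σ_w J)(ℂ)) = S¹`** for a DIAGONAL hermitian non-degenerate `J = diag d` over `L` (`N ≥ 1`): the determinants of the archimedean
local factor are exactly the complex numbers of norm one. [cite: Dieudonne1971GroupesClassiques, Chap. II §§4–5] -/
theorem mem_range_det_archLocal_iff_norm_eq_one [NeZero N] (d : Fin N → L) (hd : ∀ i, IsCMField.complexConj L (d i) = d i)
    (hd0 : ∀ i, d i ≠ 0) (w : {w : InfinitePlace L // IsComplex w}) (u : ℂˣ) :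
    u ∈ (Matrix.GeneralLinearGroup.det.comp (UnitaryGroup.archLocal L N (Matrix.diagonal d) w).subtype).range ↔ ‖(u : ℂ)‖ = 1 := by
  classical
  have hc : IsCMField.complexConj L ≠ 1 := IsCMField.complexConj_ne_one L
  have hfix := UnitaryGroup.complexConj_smul_infinitePlace L
  set r : Fin N → ℝ := fun i => (w.1.embedding (d i)).re with hr_def
  have hreal : ∀ i, w.1.embedding (d i) = ((r i : ℝ) : ℂ) := by
    intro i
    have h := UnitaryGroup.embedding_galConj (↥(maximalRealSubfield L)) L (IsCMField.complexConj L) w (hfix w.1) hc (d i)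
    rw [hd] at h
    exact (Complex.conj_eq_iff_re.1 h.symm).symm
  have hr0 : ∀ i, r i ≠ 0 := by
    intro i h0
    apply hd0 i
    have : w.1.embedding (d i) = 0 := by rw [hreal, h0]; simp
    exact (map_eq_zero _).1 this
  have hM : UnitaryGroup.archLocal L N (Matrix.diagonal d) w =
      unitaryGroupOfForm (starRingEnd ℂ) (Matrix.diagonal fun i => ((r i : ℝ) : ℂ)) := by
    show unitaryGroupOfForm (starRingEnd ℂ) ((Matrix.diagonal d).map w.1.embedding) = _
    rw [Matrix.diagonal_map (map_zero _)]
    congr 2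
    funext i
    exact hreal i
  rw [hM]
  exact mem_range_det_iff_norm_eq_one r hr0 u

end CM

end UnitaryGroup.ArchAbelianization

end Literature.NumberTheory.Automorphic
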